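import Literature.MathematicalPhysics.QuantumLattice.IsotropicMasterZero
import Literature.MathematicalPhysics.QuantumLattice.IsotropicPropagatorDecay
import Literature.MathematicalPhysics.QuantumLattice.SectorPropagatorAtZero
import HarnessLib

/-!
# `|ḡ^{(h)}_ω̄(0)| ≤ C γ^{3h}` (Benfatto–Giuliani–Mastropietro 2006, Lemma 2.2b (2.60a))

Topic `Literature/MathematicalPhysics/QuantumLattice`; the isotropic companion of
`SectorPropagatorAtZero.lean`, endpoint of `IsotropicMasterZero`. With the isotropic scale integral
`J̄(θ, r) = ∫ Φ̄(θ, t; r) dt` (coordinates `(t₀, (t₁, t₂))`), `ḡ^{(-n)}_ω̄(0,0) = (4^{-n})³ · 4ⁿ · J̄(θ̄, 4^{-n})`,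
and PROVED here:

* `isoScaleIntegral_zero` — `J̄(θ, 0) = 0`: the measure-preserving shear
  `(t₀, (t₁, t₂)) ↦ (-t₀, (-t₁, t₂ + c t₁))` flips the sign of the integrand (`isoMasterSymbol_zero_shear`);
* `norm_isoScaleIntegral_le` — `‖J̄(θ, r)‖ ≤ C r` for `r ∈ [0, 1]`, `θ ∈ [0, 2π]` (mean value inequality in
  `r`, the `r`-derivative of the master symbol being bounded on the compact parameter × box set);
* `isoPropagator_zero_eq` and **`norm_isoPropagator_zero_le`** — Lemma 2.2b:
  `‖ḡ^{(-n)}_ω̄(0, 0)‖ ≤ C · (4^{-n})³` (`= Cγ^{3h}`, a factor `γ^h` better than (2.60)).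

Everything is PROVED; the definitions are the coordinate symbol, `isoScaleIntegral`, the
coordinate equivalence `momToQ'` and the shear.

## Sources

* G. Benfatto, A. Giuliani, V. Mastropietro, Ann. Henri Poincaré 7 (2006) 809–898, §2.5
  Lemma 2.2b (2.60a) (arXiv:cond-mat/0507686 p. 12). [BenfattoGiulianiMastropietro2006]
-/

noncomputable section

open Real Set Complex Function Metric Filter MeasureTheory MeasureTheory.Measure
open scoped Topology FourierTransform
open Literature.Analysis.Calculus Literature.Analysis.Fourier

namespace Literature.MathematicalPhysics.QuantumLattice

/-! ### The coordinate symbol and the scale integral -/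

/-- The isotropic master symbol in the coordinates `q = (t₀, (t₁, t₂))`. [cite: BenfattoGiulianiMastropietro2006, §2.5 Lemma 2.2b] -/
def isoSymbolQ (μ e₀ θ r : ℝ) (q : QSpace) : ℂ := isoMasterSymbol μ e₀ (θ, q.2.1, q.2.2) q.1 r

/-- **The isotropic scale integral** `J̄(θ, r) = ∫ Φ̄(θ, t; r) dt`. [cite: BenfattoGiulianiMastropietro2006, §2.5 Lemma 2.2b] -/
def isoScaleIntegral (μ e₀ θ r : ℝ) : ℂ := ∫ q : QSpace, isoSymbolQ μ e₀ θ r q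

/-- The coordinate equivalence `t ↦ (t₀, (t₁, t₂))`. [folklore] -/
def momToQ' : MomSpace ≃ᵐ QSpace :=
  splitMomentum.trans (MeasurableEquiv.prodCongr (MeasurableEquiv.refl ℝ) MeasurableEquiv.finTwoArrow)

/-- `momToQ' t = (t 0, (t 1, t 2))`. [folklore] -/
theorem momToQ'_apply (t : MomSpace) : momToQ' t = (t 0, (t 1, t 2)) := by
  simp [momToQ', MeasurableEquiv.trans_apply, splitMomentum_apply, MeasurableEquiv.prodCongr, MeasurableEquiv.finTwoArrow_apply]

/-- `momToQ'` preserves the measure. [folklore] -/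
theorem measurePreserving_momToQ' : MeasurePreserving momToQ' (volume : Measure MomSpace) (volume : Measure QSpace) := by
  have h2 : MeasurePreserving (Prod.map id MeasurableEquiv.finTwoArrow : ℝ × (Fin 2 → ℝ) → QSpace) volume volume :=
    (MeasurePreserving.id (volume : Measure ℝ)).prod (volume_preserving_finTwoArrow ℝ)
  exact h2.comp measurePreserving_splitMomentum

/-- The lift and the coordinate symbol agree through `momToQ'`. [folklore] -/
theorem isoMasterLift_eq_isoSymbolQ (μ e₀ θ r : ℝ) (t : MomSpace) :
    isoMasterLift μ e₀ ((θ, r), t) = isoSymbolQ μ e₀ θ r (momToQ' t) := by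
  simp [isoMasterLift, isoSymbolQ, momToQ'_apply]

/-- Hence `∫ Φ̄((θ,r), t) dt = J̄(θ, r)`. [folklore] -/
theorem integral_isoMasterLift (μ e₀ θ r : ℝ) : ∫ t : MomSpace, isoMasterLift μ e₀ ((θ, r), t) = isoScaleIntegral μ e₀ θ r := by
  simp_rw [isoMasterLift_eq_isoSymbolQ]
  exact measurePreserving_momToQ'.integral_comp momToQ'.measurableEmbedding _

/-! ### Continuity, support and integrability -/

section Main

variable {μ : ℝ} (hμ₁ : -4 < μ) (hμ₂ : μ < -2 - Real.sqrt 2)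
include hμ₁ hμ₂

omit hμ₁ hμ₂ in
/-- The embedding `q ↦ ((θ, r), t(q))`. [folklore] -/
theorem continuous_qEmbed' (θ r : ℝ) :
    Continuous fun q : QSpace => (((θ, r) : ℝ × ℝ), (WithLp.toLp 2 ![q.1, q.2.1, q.2.2] : MomSpace)) := by
  refine continuous_const.prodMk ((PiLp.continuous_toLp 2 _).comp (continuous_pi fun i => ?_))
  fin_cases i
  · exact continuous_fst
  · exact continuous_fst.comp continuous_snd
  · exact continuous_snd.comp continuous_snd

omit hμ₁ hμ₂ in
/-- The coordinate symbol through the lift. [folklore] -/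
theorem isoSymbolQ_eq_isoMasterLift (μ e₀ θ r : ℝ) (q : QSpace) :
    isoSymbolQ μ e₀ θ r q = isoMasterLift μ e₀ ((θ, r), WithLp.toLp 2 ![q.1, q.2.1, q.2.2]) := by
  simp [isoMasterLift, isoSymbolQ]

/-- The coordinate symbol is continuous in `q`. [folklore] -/
theorem continuous_isoSymbolQ {e₀ : ℝ} (he : 0 < e₀) (θ r : ℝ) : Continuous (isoSymbolQ μ e₀ θ r) := by
  have h := (contDiff_isoMasterLift hμ₁ hμ₂ he (μ := μ)).continuous.comp (continuous_qEmbed' θ r)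
  exact h.congr fun q => (isoSymbolQ_eq_isoMasterLift μ e₀ θ r q).symm

/-- The box in coordinates. [folklore] -/
def isoBoxQ (μ e₀ : ℝ) : Set QSpace :=
  {q | |q.1| ≤ e₀ ∧ |q.2.1| ≤ isoNormalConst μ e₀ ∧ |q.2.2| ≤ isoTangentConst μ e₀}

/-- For `r ∈ [0, 1]`, `isoSymbolQ θ r q ≠ 0 ⟹ q ∈ box`. [cite: BenfattoGiulianiMastropietro2003, §7.1 Lemma 7.3] -/
theorem mem_isoBoxQ_of_ne_zero {e₀ : ℝ} (he : 0 < e₀) (he' : e₀ ≤ (4 + μ) / 2) {θ r : ℝ}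
    (hr : r ∈ Icc (0 : ℝ) 1) {q : QSpace} (h : isoSymbolQ μ e₀ θ r q ≠ 0) : q ∈ isoBoxQ μ e₀ :=
  abs_le_of_isoMasterSymbol_ne_zero_of_mem_Icc hμ₁ hμ₂ he he' hr h

omit hμ₁ hμ₂ in
/-- The box is closed. [folklore] -/
theorem isClosed_isoBoxQ (μ e₀ : ℝ) : IsClosed (isoBoxQ μ e₀) :=
  (isClosed_le (continuous_abs.comp continuous_fst) continuous_const).inter
    ((isClosed_le (continuous_abs.comp (continuous_fst.comp continuous_snd)) continuous_const).inter
      (isClosed_le (continuous_abs.comp (continuous_snd.comp continuous_snd)) continuous_const))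

omit hμ₁ hμ₂ in
/-- The box is compact. [folklore] -/
theorem isCompact_isoBoxQ (μ e₀ : ℝ) : IsCompact (isoBoxQ μ e₀) := by
  have hsub : isoBoxQ μ e₀ ⊆ Icc (-e₀) e₀ ×ˢ (Icc (-isoNormalConst μ e₀) (isoNormalConst μ e₀) ×ˢ
      Icc (-isoTangentConst μ e₀) (isoTangentConst μ e₀)) := by
    rintro ⟨a, b, c⟩ ⟨h1, h2, h3⟩
    exact ⟨abs_le.1 h1, abs_le.1 h2, abs_le.1 h3⟩
  exact (isCompact_Icc.prod (isCompact_Icc.prod isCompact_Icc)).of_isClosed_subset (isClosed_isoBoxQ μ e₀) hsub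

/-- Off the box the symbol vanishes (`r ∈ [0,1]`). [folklore] -/
theorem isoSymbolQ_eq_zero_of_notMem {e₀ : ℝ} (he : 0 < e₀) (he' : e₀ ≤ (4 + μ) / 2) {θ r : ℝ}
    (hr : r ∈ Icc (0 : ℝ) 1) {q : QSpace} (hq : q ∉ isoBoxQ μ e₀) : isoSymbolQ μ e₀ θ r q = 0 := by
  by_contra h
  exact hq (mem_isoBoxQ_of_ne_zero hμ₁ hμ₂ he he' hr h)

/-- The symbol is integrable (`r ∈ [0,1]`). [folklore] -/
theorem integrable_isoSymbolQ {e₀ : ℝ} (he : 0 < e₀) (he' : e₀ ≤ (4 + μ) / 2) (θ : ℝ) {r : ℝ}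
    (hr : r ∈ Icc (0 : ℝ) 1) : Integrable (isoSymbolQ μ e₀ θ r) :=
  (continuous_isoSymbolQ hμ₁ hμ₂ he θ r).integrable_of_hasCompactSupport
    ((isCompact_isoBoxQ μ e₀).of_isClosed_subset (isClosed_tsupport _)
      (closure_minimal (fun q hq => by
        by_contra h; exact hq (isoSymbolQ_eq_zero_of_notMem hμ₁ hμ₂ he he' hr h)) (isClosed_isoBoxQ μ e₀)))

/-! ### `J̄(θ, 0) = 0`: the linear shear -/

/-- The shear `(t₀, (t₁, t₂)) ↦ (-t₀, (-t₁, t₂ + c t₁))`. [cite: BenfattoGiulianiMastropietro2006, §2.5 Lemma 2.2b] -/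
def isoShearQ (μ θ : ℝ) (q : QSpace) : QSpace := (-q.1, (-q.2.1, q.2.2 + isoZeroShift μ θ * q.2.1))

omit hμ₁ hμ₂ in
/-- **The shear preserves the Lebesgue measure.** [folklore] -/
theorem measurePreserving_isoShearQ (θ : ℝ) : MeasurePreserving (isoShearQ μ θ) (volume : Measure QSpace) volume := by
  have hneg : MeasurePreserving (Neg.neg : ℝ → ℝ) volume volume := Measure.measurePreserving_neg _
  have hskew : MeasurePreserving (fun p : ℝ × ℝ => (-p.1, p.2 + isoZeroShift μ θ * p.1)) (volume : Measure (ℝ × ℝ)) volume := by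
    rw [Measure.volume_eq_prod]
    refine hneg.skew_product (g := fun a b => b + isoZeroShift μ θ * a) ?_ ?_
    · exact (continuous_snd.add (continuous_const.mul continuous_fst)).measurable
    · exact ae_of_all _ fun a => (measurePreserving_add_right (volume : Measure ℝ) (isoZeroShift μ θ * a)).map_eq
  have := hneg.prod hskew
  rw [Measure.volume_eq_prod]
  exact this

/-- The integrand changes sign under the shear at `r = 0`. [cite: BenfattoGiulianiMastropietro2006, §2.5 Lemma 2.2b] -/
theorem isoSymbolQ_shear (e₀ θ : ℝ) (q : QSpace) :
    isoSymbolQ μ e₀ θ 0 (isoShearQ μ θ q) = -isoSymbolQ μ e₀ θ 0 q := by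
  simp only [isoSymbolQ, isoShearQ]
  exact isoMasterSymbol_zero_shear hμ₁ hμ₂ e₀ θ q.1 q.2.1 q.2.2

/-- **`J̄(θ, 0) = 0`.** [cite: BenfattoGiulianiMastropietro2006, §2.5 Lemma 2.2b] -/
theorem isoScaleIntegral_zero {e₀ : ℝ} (he : 0 < e₀) (θ : ℝ) : isoScaleIntegral μ e₀ θ 0 = 0 := by
  have hσ := measurePreserving_isoShearQ θ (μ := μ)
  have hcont := continuous_isoSymbolQ hμ₁ hμ₂ he θ 0 (μ := μ) (e₀ := e₀)
  have h1 : ∫ q, isoSymbolQ μ e₀ θ 0 (isoShearQ μ θ q) = ∫ q, isoSymbolQ μ e₀ θ 0 q := by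
    have := integral_map hσ.measurable.aemeasurable (hcont.aestronglyMeasurable (μ := Measure.map (isoShearQ μ θ) volume))
    rw [hσ.map_eq] at this
    exact this.symm
  have h2 : ∫ q, isoSymbolQ μ e₀ θ 0 (isoShearQ μ θ q) = -∫ q, isoSymbolQ μ e₀ θ 0 q := by
    simp_rw [isoSymbolQ_shear hμ₁ hμ₂]
    exact integral_neg _
  rw [isoScaleIntegral]
  linear_combination (1 / 2 : ℂ) * (h1.symm.trans h2)

/-! ### `‖J̄(θ, r)‖ ≤ C r` -/

omit hμ₁ hμ₂ in
/-- First derivatives in the scale direction are bounded by the full derivative of the lift: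
`‖∂_u Φ((θ,u),t)|_{u=s}‖ ≤ ‖DΦ((θ,s),t)‖`. [folklore] -/
theorem norm_deriv_scale_le {F : (ℝ × ℝ) × MomSpace → ℂ} (hF : ContDiff ℝ ((⊤ : ℕ∞) : WithTop ℕ∞) F)
    (θ s : ℝ) (t : MomSpace) :
    ‖deriv (fun u : ℝ => F ((θ, u), t)) s‖ ≤ ‖fderiv ℝ F ((θ, s), t)‖ := by
  have hline : HasDerivAt (fun u : ℝ => (((θ, u), t) : (ℝ × ℝ) × MomSpace)) ((((0 : ℝ), (1 : ℝ)), (0 : MomSpace))) s :=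
    ((hasDerivAt_const s θ).prodMk (hasDerivAt_id s)).prodMk (hasDerivAt_const s t)
  have hd : DifferentiableAt ℝ F ((θ, s), t) := (hF.differentiable (by simp)).differentiableAt
  have hcomp : HasDerivAt (fun u : ℝ => F ((θ, u), t)) (fderiv ℝ F ((θ, s), t) (((0 : ℝ), (1 : ℝ)), (0 : MomSpace))) s :=
    hd.hasFDerivAt.comp_hasDerivAt s hline
  rw [hcomp.deriv]
  refine (ContinuousLinearMap.le_opNorm _ _).trans ?_
  have hv : ‖((((0 : ℝ), (1 : ℝ)), (0 : MomSpace)) : (ℝ × ℝ) × MomSpace)‖ ≤ 1 := by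
    simp [Prod.norm_def]
  exact mul_le_of_le_one_right (norm_nonneg _) hv

/-- **`‖J̄(θ, r)‖ ≤ C r`** for `θ ∈ [0, 2π]`, `r ∈ [0, 1]` (`J̄(θ,0) = 0` and the mean value inequality
in `r` with the `r`-derivative of the integrand bounded on the support box). [cite: BenfattoGiulianiMastropietro2006, §2.5 Lemma 2.2b] -/
theorem norm_isoScaleIntegral_le {e₀ : ℝ} (he : 0 < e₀) (he' : e₀ ≤ (4 + μ) / 2) :
    ∃ C : ℝ, 0 ≤ C ∧ ∀ θ ∈ Icc 0 (2 * π), ∀ r ∈ Icc (0 : ℝ) 1, ‖isoScaleIntegral μ e₀ θ r‖ ≤ C * r := by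
  set P : Set (ℝ × ℝ) := Icc 0 (2 * π) ×ˢ Icc (0 : ℝ) 1 with hP
  set T : Set MomSpace := {t | |t 0| ≤ e₀ ∧ |t 1| ≤ isoNormalConst μ e₀ ∧ |t 2| ≤ isoTangentConst μ e₀} with hT
  have hK : IsCompact (P ×ˢ T) := (isCompact_Icc.prod isCompact_Icc).prod (isCompact_momBox _ _ _)
  have hF := contDiff_isoMasterLift hμ₁ hμ₂ he (μ := μ)
  have hcont : ContinuousOn (fun q : (ℝ × ℝ) × MomSpace => fderiv ℝ (isoMasterLift μ e₀) q) (P ×ˢ T) :=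
    (hF.continuous_fderiv (by simp)).continuousOn
  obtain ⟨B, hB⟩ := hK.exists_bound_of_continuousOn hcont
  set B' : ℝ := max B 0 with hB'
  have hB'0 : 0 ≤ B' := le_max_right _ _
  set V : ℝ := (volume (isoBoxQ μ e₀)).toReal with hV
  have hVfin : volume (isoBoxQ μ e₀) < ⊤ := (isCompact_isoBoxQ μ e₀).measure_lt_top
  refine ⟨B' * V, by positivity, fun θ hθ r hr => ?_⟩
  -- pointwise mean value inequality
  set φ : QSpace → ℝ → ℂ := fun q u => isoSymbolQ μ e₀ θ u q with hφ
  have hφeq : ∀ q, φ q = fun u : ℝ => isoMasterLift μ e₀ ((θ, u), WithLp.toLp 2 ![q.1, q.2.1, q.2.2]) := fun q => by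
    funext u; exact isoSymbolQ_eq_isoMasterLift μ e₀ θ u q
  have hpt : ∀ q, ‖φ q r - φ q 0‖ ≤ (isoBoxQ μ e₀).indicator (fun _ => B' * r) q := by
    intro q
    by_cases hq : q ∈ isoBoxQ μ e₀
    · rw [indicator_of_mem hq]
      have hd : ∀ u ∈ Icc (0 : ℝ) 1, DifferentiableAt ℝ (φ q) u := fun u _ => by
        rw [hφeq]; exact ((hF.comp ((contDiff_const.prodMk contDiff_id).prodMk contDiff_const)).differentiable (by simp)).differentiableAt
      have hbd : ∀ u ∈ Icc (0 : ℝ) 1, ‖deriv (φ q) u‖ ≤ B' := fun u hu => by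
        rw [hφeq]
        refine (norm_deriv_scale_le hF θ u _).trans ((hB _ (mk_mem_prod ⟨hθ, hu⟩ ?_)).trans (le_max_left _ _))
        obtain ⟨hq1, hq2, hq3⟩ := hq
        exact ⟨by simpa using hq1, by simpa using hq2, by simpa using hq3⟩
      have hmvt := (convex_Icc (0 : ℝ) 1).norm_image_sub_le_of_norm_deriv_le hd hbd
        (left_mem_Icc.2 zero_le_one) hr
      rw [sub_zero, Real.norm_eq_abs, abs_of_nonneg hr.1] at hmvt
      exact hmvt
    · rw [indicator_of_notMem hq]
      have h0 : (0 : ℝ) ∈ Icc (0 : ℝ) 1 := ⟨le_rfl, zero_le_one⟩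
      simp only [hφ, isoSymbolQ_eq_zero_of_notMem hμ₁ hμ₂ he he' hr hq, isoSymbolQ_eq_zero_of_notMem hμ₁ hμ₂ he he' h0 hq,
        sub_zero, norm_zero, le_refl]
  -- `J̄(r) = J̄(r) - J̄(0) = ∫ (φ(r) - φ(0))`
  have h0 : (0 : ℝ) ∈ Icc (0 : ℝ) 1 := ⟨le_rfl, zero_le_one⟩
  have hi := integrable_isoSymbolQ hμ₁ hμ₂ he he' θ hr
  have hi0 := integrable_isoSymbolQ hμ₁ hμ₂ he he' θ h0
  have hJ : isoScaleIntegral μ e₀ θ r = ∫ q, (φ q r - φ q 0) := by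
    rw [integral_sub hi hi0]
    change isoScaleIntegral μ e₀ θ r = isoScaleIntegral μ e₀ θ r - isoScaleIntegral μ e₀ θ 0
    rw [isoScaleIntegral_zero hμ₁ hμ₂ he, sub_zero]
  have hind : Integrable ((isoBoxQ μ e₀).indicator fun _ : QSpace => B' * r) volume :=
    (integrable_indicator_iff (isClosed_isoBoxQ μ e₀).measurableSet).2 (integrableOn_const hVfin.ne)
  have hnorm := norm_integral_le_of_norm_le hind (ae_of_all _ hpt)
  rw [integral_indicator (isClosed_isoBoxQ μ e₀).measurableSet, setIntegral_const, smul_eq_mul] at hnorm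
  rw [hJ]
  calc ‖∫ q, (φ q r - φ q 0)‖ ≤ V * (B' * r) := hnorm
    _ = B' * V * r := by ring

/-! ### The propagator at the origin -/

/-- **`ḡ^{(-n)}_ω̄(0, 0) = (4^{-n})³ · 4ⁿ · J̄(θ̄_{n,ω̄}, 4^{-n})`.** [cite: BenfattoGiulianiMastropietro2006, §2.5 Lemma 2.2b] -/
theorem isoPropagator_zero_eq {e₀ : ℝ} (he : 0 < e₀) (he' : e₀ ≤ (4 + μ) / 2) (n : ℕ) (ω : ℤ) :
    isoPropagator e₀ μ n ω 0 0 =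
      ((((4 : ℝ) ^ (-(n : ℤ)) * (4 : ℝ) ^ (-(n : ℤ)) * (4 : ℝ) ^ (-(n : ℤ))) * (4 : ℝ) ^ n : ℝ) : ℂ) *
        isoScaleIntegral μ e₀ (((ω : ℝ) + 1 / 2) * sectorWidth (2 * n)) ((4 : ℝ) ^ (-(n : ℤ))) := by
  set θ₀ : ℝ := ((ω : ℝ) + 1 / 2) * sectorWidth (2 * n) with hθ₀
  set A := isoChart hμ₁ hμ₂ θ₀ n with hA
  have hdet : (4 : ℝ) ^ (-(n : ℤ)) * (4 : ℝ) ^ (-(n : ℤ)) * (4 : ℝ) ^ (-(n : ℤ)) > 0 := by positivity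
  have h0 : dualPoint 0 0 = (0 : MomSpace) := by
    ext i; fin_cases i <;> simp [dualPoint]
  rw [isoPropagator_eq_fourier, h0, Real.fourier_eq']
  simp only [inner_zero_right, mul_zero, Complex.ofReal_zero, zero_mul, Complex.exp_zero, one_smul]
  rw [isoSymbolE_eq_comp hμ₁ hμ₂]
  rw [show (∫ v : MomSpace, ((rescaledIsoSymbol hμ₁ hμ₂ e₀ n ω ∘ A.symm) ∘ fun q => q + -fermiBasePoint μ θ₀) v) =
      ∫ v : MomSpace, (rescaledIsoSymbol hμ₁ hμ₂ e₀ n ω ∘ A.symm) v from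
    integral_add_right_eq_self (μ := (volume : Measure MomSpace)) (rescaledIsoSymbol hμ₁ hμ₂ e₀ n ω ∘ A.symm) _]
  simp only [Function.comp_apply]
  rw [integral_comp_continuousLinearEquiv volume A.symm, det_isoChart_symm hμ₁ hμ₂, inv_inv, abs_of_pos hdet]
  rw [rescaledIsoSymbol_eq_smul_isoMasterLift hμ₁ hμ₂ he he' n ω]
  simp only
  rw [integral_smul, integral_isoMasterLift, smul_eq_mul, Complex.real_smul]
  push_cast
  ring

/-- **Lemma 2.2b of Benfatto–Giuliani–Mastropietro (2006)**: for `-4 < μ < -2 - √2`,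
`0 < e₀ ≤ (4+μ)/2` there is `C` with `‖ḡ^{(-n)}_ω̄(0, 0)‖ ≤ C · (4^{-n})³` (`= Cγ^{3h}`) for all `n` and all
isotropic sectors `0 ≤ ω̄ < 2·4ⁿ`. [cite: BenfattoGiulianiMastropietro2006, §2.5 Lemma 2.2b (2.60a)] -/
theorem norm_isoPropagator_zero_le {e₀ : ℝ} (he : 0 < e₀) (he' : e₀ ≤ (4 + μ) / 2) :
    ∃ C : ℝ, 0 ≤ C ∧ ∀ (n : ℕ) (ω : ℕ), ω < sectorCount (2 * n) →
      ‖isoPropagator e₀ μ n ω 0 0‖ ≤ C * ((4 : ℝ) ^ (-(n : ℤ)) * (4 : ℝ) ^ (-(n : ℤ)) * (4 : ℝ) ^ (-(n : ℤ))) := by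
  obtain ⟨C, hC0, hC⟩ := norm_isoScaleIntegral_le hμ₁ hμ₂ he he'
  refine ⟨C, hC0, fun n ω hω => ?_⟩
  set θ₀ : ℝ := ((ω : ℝ) + 1 / 2) * sectorWidth (2 * n) with hθ₀
  have hθ : θ₀ ∈ Icc 0 (2 * π) := by
    have hw := sectorWidth_pos (2 * n)
    have hN := sectorCount_mul_sectorWidth (2 * n)
    have hω' : (ω : ℝ) + 1 ≤ sectorCount (2 * n) := by exact_mod_cast hω
    refine ⟨by positivity, ?_⟩
    calc ((ω : ℝ) + 1 / 2) * sectorWidth (2 * n) ≤ (sectorCount (2 * n) : ℝ) * sectorWidth (2 * n) :=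
          mul_le_mul_of_nonneg_right (by linarith) hw.le
      _ = 2 * π := hN
  have hr1 : (4 : ℝ) ^ (-(n : ℤ)) ∈ Icc (0 : ℝ) 1 :=
    ⟨(zpow_pos (by norm_num : (0 : ℝ) < 4) (-(n : ℤ))).le, zpow_le_one_of_nonpos₀ (by norm_num) (by simp)⟩
  have h44 : (4 : ℝ) ^ n * (4 : ℝ) ^ (-(n : ℤ)) = 1 := by rw [zpow_neg, zpow_natCast, mul_inv_cancel₀ (by positivity)]
  have hJ := hC θ₀ hθ _ hr1
  have heq := isoPropagator_zero_eq hμ₁ hμ₂ he he' n (ω : ℤ)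
  rw [Int.cast_natCast] at heq
  rw [heq, norm_mul, Complex.norm_real, Real.norm_eq_abs, abs_of_pos (by positivity)]
  calc (4 : ℝ) ^ (-(n : ℤ)) * (4 : ℝ) ^ (-(n : ℤ)) * (4 : ℝ) ^ (-(n : ℤ)) * (4 : ℝ) ^ n *
        ‖isoScaleIntegral μ e₀ θ₀ ((4 : ℝ) ^ (-(n : ℤ)))‖
      ≤ (4 : ℝ) ^ (-(n : ℤ)) * (4 : ℝ) ^ (-(n : ℤ)) * (4 : ℝ) ^ (-(n : ℤ)) * (4 : ℝ) ^ n * (C * (4 : ℝ) ^ (-(n : ℤ))) :=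
        mul_le_mul_of_nonneg_left hJ (by positivity)
    _ = C * ((4 : ℝ) ^ (-(n : ℤ)) * (4 : ℝ) ^ (-(n : ℤ)) * (4 : ℝ) ^ (-(n : ℤ))) * ((4 : ℝ) ^ n * (4 : ℝ) ^ (-(n : ℤ))) := by
        ring
    _ = C * ((4 : ℝ) ^ (-(n : ℤ)) * (4 : ℝ) ^ (-(n : ℤ)) * (4 : ℝ) ^ (-(n : ℤ))) := by rw [h44, mul_one]

end Main

end Literature.MathematicalPhysics.QuantumLattice

end
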